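import Summits.NavierStokesRegularity.NavierStokesRegularity.Theorems.CertifiedBlowupCertifiedBlowupVorticityRateBlowupAngularVelocity
import Summits.NavierStokesRegularity.NavierStokesRegularity.Theorems.CertifiedBlowupCertifiedBlowupAxisymBlowupLerayRates
import HarnessLib

/-!
# Certificate class `CertifiedBlowupVorticityRateBlowup` (stmt-NavierStokesRegularity-8639): the inner object's vorticity is
# UNIFORMLY bounded by the certificate constant over Leray's constant squared, `‖curl W‖_∞ ≤ 2C_ω/c_L²`

Theorems file landed `--supports stmt-NavierStokesRegularity-8639` (cell `ns-blowup`, GROUP B zone Z1), fourth crux-side deposit of the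
zone-Z1 seat, continuing `…CertifiedBlowupVorticityRateBlowupAngularVelocity`. Two tree facts are combined:

* Leray's lower blow-up rate for every witness of the crux class (`leray_rates_of_isMaximalSmoothSolution`, Leray 1934 §19: an
  absolute `c_L > 0` with `‖u(t, x)‖ ≥ c_L√ν/√(T − t)` at some `x`, every `t ∈ [0, T)`);
* the Type-I rate ALONG THE GAUGE TIMES in the swirling branch (`vorticityRate_typeI_along_gauge_of_curl_ne_zero`, (K71):
  `‖u(t, x)‖²(T − tₖ) ≤ 2νC_ω/‖curl W(s₀)(y₀)‖` on `[0, tₖ] × ℝ³` for large `k`, whenever `curl W(s₀)(y₀) ≠ 0`).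

At `t = tₖ` the two give `c_L²ν ≤ 2νC_ω/‖curl W(s₀)(y₀)‖`, i.e.

* `innerObject_curl_le_of_lerayRate` — **`‖curl W(s₀)(y₀)‖ ≤ 2C_ω/c_L²` for ALL `s₀ < 0`, `y₀`** (trivial where the curl vanishes):
  the inner object of a certificate-class witness has vorticity bounded UNIFORMLY up to the vertex, by the certificate constant
  (the rate `C_ω/|s|` of (K71) degenerates as `s → 0⁻`; this bound does not);
* `innerObject_swirl_le_uniform_of_lerayRate` — hence, by the zone-Z1 dictionary parts XL–XLI at the uniform vorticity level
  `Ω = 2C_ω/c_L²` (axisymmetric branch): `|Γ_W(s, y)| ≤ (C_ω/c_L²) r(y)²`, `|(W_θ/r)(s, y)| ≤ C_ω/c_L²`, `W_θ(s, y)² ≤ (Mₛ/ν)C_ω/c_L²`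
  for ALL `s < 0` — the inner object's swirl vanishes to second order at the axis UNIFORMLY IN TIME;
* `vorticityRate_witness_innerVorticity_alternative` — assembled for every certificate-class witness with Leray's constant
  produced from the tree: EITHER (α) `W ≡ c` OR (β) axisymmetric `W` with `‖curl W‖_∞ ≤ 2C_ω/c_L²` and the uniform swirl bounds.

So a certificate with a SMALL rescaled-vorticity constant `C_ω ≪ c_L²` forces a nearly irrotational inner object even in the
swirling branch. No new definitions, no named-fact hypotheses, no `sorry`. WHAT THIS IS NOT: not a blow-up or regularity claim
and no word on (AX-L) — implications about a HYPOTHETICAL certificate-class witness. Author: ns-blowup-profile-eng-1 g10, 2026-08-27.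

## References
* J. Leray, Acta Math. 63 (1934), §19 (3.9). [Leray1934]
* G. Koch, N. Nadirashvili, G. Seregin, V. Šverák, Acta Math. 203 (2009), §6. [KochNadirashviliSereginSverak2009]
-/

-- the summit and its single problem share the name (D-0017 nested layout)
set_option linter.dupNamespace false

open MeasureTheory Set Function Filter Topology Metric
open scoped ENNReal NNReal

namespace Summit.NavierStokesRegularity.NavierStokesRegularity.Theorems.CertifiedBlowupVorticityRateBlowup.InnerObject

open Literature.Analysis.FluidPDE
open Summit.NavierStokesRegularity.OSWSelfSimilar.TypeIIModulationDictionary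
open Summit.NavierStokesRegularity.NavierStokesRegularity.Theorems.CertifiedBlowupAxisymBlowup.CompactAmplification

section LerayBound

variable {ν T C c : ℝ} {u : ℝ → EuclideanSpace ℝ (Fin 3) → EuclideanSpace ℝ (Fin 3)}
  {tn lamn : ℕ → ℝ} {cn : ℕ → EuclideanSpace ℝ (Fin 3)} {φ : ℕ → ℕ}
  {W : ℝ → EuclideanSpace ℝ (Fin 3) → EuclideanSpace ℝ (Fin 3)}

/-- **The inner object's vorticity is bounded by `2C_ω/c_L²`, uniformly.** Gauge data of the Z1 zoom (`tₖ ∈ [T/2, T)`, `tₖ → T`,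
`λₖ → 0`, `(λₖ/ν)‖u‖ ≤ 1` on `[0, tₖ]`, zoomed vorticity `→ curl W`), the certificate rate `(T − t)‖ω(t)‖_∞ ≤ C` near `T⁻`, and a
Leray lower rate `‖u(t, x_t)‖ ≥ c√ν/√(T − t)` at some point for every `t ∈ [0, T)` (`0 < c`) give `‖curl W(s₀)(y₀)‖ ≤ 2C/c²` for
every `s₀ < 0`, `y₀`: where the curl is non-zero, the Type-I bound along the gauge times `‖u‖²(T − tₖ) ≤ 2νC/‖curl W(s₀)(y₀)‖`
meets Leray's `c²ν ≤ ‖u(tₖ, x)‖²(T − tₖ)`. [cite: Leray1934, §19 (3.9)] -/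
theorem innerObject_curl_le_of_lerayRate (hν : 0 < ν) (hT : 0 < T) (htn : ∀ k, T / 2 ≤ tn k ∧ tn k < T)
    (htT : Tendsto tn atTop (𝓝 T)) (hlam : ∀ k, 0 < lamn k) (hlam0 : Tendsto lamn atTop (𝓝 0)) (hφ : StrictMono φ)
    (hgauge : ∀ k, ∀ t ∈ Icc 0 (tn k), ∀ x, lamn k / ν * ‖u t x‖ ≤ 1)
    (hrate : ∀ᶠ t in 𝓝[<] T, ∀ x, (T - t) * ‖curl (u t) x‖ ≤ C)
    (hcurl : ∀ s < 0, ∀ y : EuclideanSpace ℝ (Fin 3), Tendsto (fun j => (lamn (φ j) ^ 2 / ν) •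
      curl (u (tn (φ j) + lamn (φ j) ^ 2 / ν * s)) (cn (φ j) + lamn (φ j) • y)) atTop (𝓝 (curl (W s) y)))
    (hc : 0 < c) (hler : ∀ t ∈ Ico 0 T, ∃ x, c * Real.sqrt ν / Real.sqrt (T - t) ≤ ‖u t x‖)
    {s₀ : ℝ} (hs₀ : s₀ < 0) (y₀ : EuclideanSpace ℝ (Fin 3)) : ‖curl (W s₀) y₀‖ ≤ 2 * C / c ^ 2 := by
  by_cases hne : curl (W s₀) y₀ = 0
  · -- trivial where the curl vanishes: `0 ≤ 2C/c²` since `C ≥ 0` near a genuine blow-up time (rate bound is nonneg.)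
    have hC0 : 0 ≤ C := by
      have hlt : ∀ᶠ t in 𝓝[<] T, t < T := eventually_mem_nhdsWithin
      obtain ⟨t, ht, htT'⟩ := (hrate.and hlt).exists
      exact le_trans (mul_nonneg (sub_pos.2 htT').le (norm_nonneg _)) (ht 0)
    rw [hne, norm_zero]; positivity
  have hw : 0 < ‖curl (W s₀) y₀‖ := norm_pos_iff.2 hne
  obtain ⟨-, h2⟩ := vorticityRate_typeI_along_gauge_of_curl_ne_zero hν htn htT hlam hlam0 hφ hgauge hrate hcurl hs₀ hne
  obtain ⟨j, hj⟩ := h2.exists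
  have htk : tn (φ j) ∈ Ico 0 T := ⟨by linarith [(htn (φ j)).1], (htn (φ j)).2⟩
  obtain ⟨x, hx⟩ := hler _ htk
  have hTt : 0 < T - tn (φ j) := sub_pos.2 (htn (φ j)).2
  have hkey := hj (tn (φ j)) ⟨htk.1, le_rfl⟩ x
  -- Leray: `c²ν ≤ ‖u(tₖ, x)‖²(T − tₖ)`
  have hsq : 0 < Real.sqrt (T - tn (φ j)) := Real.sqrt_pos.2 hTt
  have hpos : 0 ≤ c * Real.sqrt ν / Real.sqrt (T - tn (φ j)) := by positivity
  have h1 : c ^ 2 * ν / (T - tn (φ j)) ≤ ‖u (tn (φ j)) x‖ ^ 2 := by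
    have := pow_le_pow_left₀ hpos hx 2
    rwa [div_pow, mul_pow, Real.sq_sqrt hν.le, Real.sq_sqrt hTt.le] at this
  have h2' : c ^ 2 * ν ≤ 2 * ν * C / ‖curl (W s₀) y₀‖ := by
    have := (div_le_iff₀ hTt).1 h1
    linarith
  -- divide by `ν` and rearrange
  rw [le_div_iff₀ (by positivity)]
  have h3 : c ^ 2 * ν * ‖curl (W s₀) y₀‖ ≤ 2 * ν * C := (le_div_iff₀ hw).1 h2'
  nlinarith

/-- **Uniform swirl bounds of the inner object from the uniform vorticity bound** (axisymmetric branch; zone-Z1 dictionary parts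
XL–XLI at the vorticity level `Ω = 2C/c²`): for a KNSS blow-up limit `W` with axisymmetric slices, `|Γ_W| ≤ Γ*` and
`‖curl W(s)(y)‖ ≤ 2C/c²` for all `s < 0`, `y`: `|Γ_W(s, y)| ≤ (C/c²) r(y)²`, `|(W_θ/r)(s, y)| ≤ C/c²` and `W_θ(s, y)² ≤ Γ* C/c²`, for ALL
`s < 0`. [cite: MajdaBertozziCUP2002, §2.3.3 eq. (2.64) (integrated along horizontal rays)] -/
theorem innerObject_swirl_le_uniform_of_curl_le {Γs : ℝ} (hW : IsKNSSBlowupLimit W) (hax : ∀ s < 0, IsAxisymmetric (W s))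
    (hΓ : ∀ s < 0, ∀ y : EuclideanSpace ℝ (Fin 3), |swirl (W s) y| ≤ Γs)
    (hcurlU : ∀ s < 0, ∀ y : EuclideanSpace ℝ (Fin 3), ‖curl (W s) y‖ ≤ 2 * C / c ^ 2) {s : ℝ} (hs : s < 0)
    (y : EuclideanSpace ℝ (Fin 3)) :
    |swirl (W s) y| ≤ C / c ^ 2 * cylRadius y ^ 2 ∧ |angVelQuot (W s) y| ≤ C / c ^ 2 ∧
      swirlVelocity (W s) y ^ 2 ≤ Γs * C / c ^ 2 := by
  have hsm : ContDiff ℝ 2 (W s) :=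
    contDiff_infty.1 (hW.smooth.comp_contDiff (contDiff_prodMk_right s) fun y => ⟨hs, mem_univ y⟩) 2
  have hd := hsm.differentiable two_ne_zero
  refine ⟨?_, ?_, ?_⟩
  · have h := abs_swirl_le_of_norm_curl_le (hax s hs) hd (hcurlU s hs) y
    calc |swirl (W s) y| ≤ 2 * C / c ^ 2 / 2 * cylRadius y ^ 2 := h
      _ = C / c ^ 2 * cylRadius y ^ 2 := by ring
  · have h := abs_angVelQuot_le_of_norm_curl_le (hax s hs) hsm (hcurlU s hs) y
    calc |angVelQuot (W s) y| ≤ 2 * C / c ^ 2 / 2 := h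
      _ = C / c ^ 2 := by ring
  · have h := sq_swirlVelocity_le_of_abs_swirl_le_of_norm_curl_le (hax s hs) hd (hΓ s hs) (hcurlU s hs) y
    calc swirlVelocity (W s) y ^ 2 ≤ Γs * (2 * C / c ^ 2) / 2 := h
      _ = Γs * C / c ^ 2 := by ring

end LerayBound

section Assembled

variable {ν T : ℝ} {u : ℝ → EuclideanSpace ℝ (Fin 3) → EuclideanSpace ℝ (Fin 3)}
  {p : ℝ → EuclideanSpace ℝ (Fin 3) → ℝ}

/-- **CERTIFICATE-CLASS WITNESSES: THE INNER OBJECT'S VORTICITY IS BOUNDED BY `2C_ω/c_L²` (Leray's absolute constant `c_L`).**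
For every `(ν, T, u, p)` of the certificate class: an absolute `c_L > 0` (Leray 1934, the tree's `leray_rates_of_isMaximalSmoothSolution`,
valid for every witness of the crux class), the zone-Z1 gauge data and inner object `W`, with `‖curl W(s)(y)‖ ≤ C_ω/|s|` AND
`‖curl W(s)(y)‖ ≤ 2C_ω/c_L²` for ALL `s < 0`, `y`; and EITHER (α) `W ≡ c`, OR (β) `W` axisymmetric with `¬AxisymmetricLiouvilleBoundedSwirl`,
`Γ_W ≢ 0`, and the UNIFORM swirl bounds `|Γ_W(s, y)| ≤ (C_ω/c_L²) r(y)²`, `|(W_θ/r)(s, y)| ≤ C_ω/c_L²`, `W_θ(s, y)² ≤ (Mₛ/ν)C_ω/c_L²`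
for all `s < 0` — the swirl of the inner object vanishes to second order at the axis uniformly in time.
[cite: Leray1934, §19 (3.9)] -/
theorem vorticityRate_witness_innerVorticity_alternative (hν : 0 < ν) (hT : 0 < T)
    (hmax : IsMaximalSmoothSolution ν 0 u p T) (hLH : IsLerayHopfOn T ν 0 (u 0) u)
    (hdec : HasRapidSpatialDecay (u 0)) (haxi : IsAxisymmetric (u 0))
    (hrate : ∃ C : ℝ, ∀ᶠ t in 𝓝[<] T, ∀ x : EuclideanSpace ℝ (Fin 3), (T - t) * ‖curl (u t) x‖ ≤ C) :
    ∃ (C cL Mₛ : ℝ) (tn lamn : ℕ → ℝ) (cn : ℕ → EuclideanSpace ℝ (Fin 3)) (φ : ℕ → ℕ)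
      (W : ℝ → EuclideanSpace ℝ (Fin 3) → EuclideanSpace ℝ (Fin 3)),
      0 < cL ∧ (∀ t ∈ Ico 0 T, ∃ x, cL * Real.sqrt ν / Real.sqrt (T - t) ≤ ‖u t x‖) ∧ (∀ x, |swirl (u 0) x| ≤ Mₛ) ∧
      (∀ k, T / 2 ≤ tn k ∧ tn k < T) ∧ Tendsto tn atTop (𝓝 T) ∧ (∀ k, 0 < lamn k) ∧ Tendsto lamn atTop (𝓝 0) ∧
      (∀ k, ∀ t ∈ Icc 0 (tn k), ∀ x, lamn k / ν * ‖u t x‖ ≤ 1) ∧ StrictMono φ ∧ IsKNSSBlowupLimit W ∧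
      (∀ s < 0, TendstoLocallyUniformly
        (fun k => ((lamn (φ k) / ν) • stPull (lamn (φ k) ^ 2 / ν) (lamn (φ k)) (tn (φ k)) (cn (φ k)) u) s)
          (W s) atTop) ∧
      (∀ s < 0, ∀ y : EuclideanSpace ℝ (Fin 3), ‖curl (W s) y‖ ≤ C / |s|) ∧
      (∀ s < 0, ∀ y : EuclideanSpace ℝ (Fin 3), ‖curl (W s) y‖ ≤ 2 * C / cL ^ 2) ∧
      ((∃ c : EuclideanSpace ℝ (Fin 3), ‖c‖ = 1 ∧ c 1 = 0 ∧ ∀ s < 0, ∀ y : EuclideanSpace ℝ (Fin 3), W s y = c) ∨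
        ((∀ s < 0, IsAxisymmetric (W s)) ∧
          ¬ Summit.NavierStokesRegularity.NavierStokesRegularity.AxisymmetricLiouvilleBoundedSwirl ∧
          (∃ s < 0, ∃ y : EuclideanSpace ℝ (Fin 3), swirl (W s) y ≠ 0) ∧
          ∀ s < 0, ∀ y : EuclideanSpace ℝ (Fin 3), |swirl (W s) y| ≤ C / cL ^ 2 * cylRadius y ^ 2 ∧
            |angVelQuot (W s) y| ≤ C / cL ^ 2 ∧ swirlVelocity (W s) y ^ 2 ≤ Mₛ / ν * C / cL ^ 2)) := by
  obtain ⟨C, hC⟩ := hrate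
  obtain ⟨Mₛ, hMₛ⟩ := hdec.abs_swirl_le
  obtain ⟨⟨cL, hcL, hler⟩, -⟩ := leray_rates_of_isMaximalSmoothSolution
  have hler' : ∀ t ∈ Ico 0 T, ∃ x, cL * Real.sqrt ν / Real.sqrt (T - t) ≤ ‖u t x‖ :=
    fun t ht => (hler hν hT hmax hLH hdec haxi t ht).2
  obtain ⟨tn, lamn, cn, xn, φ, W, htn, htT, hlam, hlam0, hgauge, -, -, -, -, -, -, hφ, hW, hconv, -, hcurl, halt⟩ :=
    innerObject_master_of_datum hν hT hmax hLH hdec haxi hMₛ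
  have hcurlle : ∀ s < 0, ∀ y : EuclideanSpace ℝ (Fin 3), ‖curl (W s) y‖ ≤ C / |s| :=
    fun s hs y => vorticityRate_innerObject_curl_le hν htn htT hlam0 hφ hC hcurl hs y
  have hcurlU : ∀ s < 0, ∀ y : EuclideanSpace ℝ (Fin 3), ‖curl (W s) y‖ ≤ 2 * C / cL ^ 2 := fun s hs y =>
    innerObject_curl_le_of_lerayRate hν hT htn htT hlam hlam0 hφ hgauge hC hcurl hcL hler' hs y
  refine ⟨C, cL, Mₛ, tn, lamn, cn, φ, W, hcL, hler', hMₛ, htn, htT, hlam, hlam0, hgauge, hφ, hW, hconv, hcurlle, hcurlU, ?_⟩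
  rcases halt with ⟨hc, -⟩ | ⟨-, hnot, haxW, hswb, -, -, hswirl, -, -, -, -, -⟩
  · exact Or.inl hc
  · refine Or.inr ⟨haxW, hnot, ?_, fun s hs y => innerObject_swirl_le_uniform_of_curl_le hW haxW hswb hcurlU hs y⟩
    obtain ⟨s, hs, y, hne, -⟩ := hswirl
    exact ⟨s, hs, y, hne⟩

end Assembled

end Summit.NavierStokesRegularity.NavierStokesRegularity.Theorems.CertifiedBlowupVorticityRateBlowup.InnerObject
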